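import Literature.NumberTheory.Automorphic.GodementCompactness
import Literature.NumberTheory.Automorphic.AutomorphicGaloisConj
import Literature.NumberTheory.Automorphic.ReductionTheoryGLn
import Literature.NumberTheory.QuadraticForms.LandherrHermitianMatricesDiagonalize
import HarnessLib

/-!
# The set of rational hermitian matrices carried into a box by an adelic matrix

Topic `NumberTheory/Automorphic`; namespace `Literature.NumberTheory.Automorphic`. THEOREMS ONLY
(no definition, no instance, no named fact, no `sorry`).

Let `L` be a CM number field with complex conjugation `c`, `𝔸_L` its adele ring and
`X · g = (c g)ᵀ X g` the right action of `GL_N(𝔸_L)` on `M_N(𝔸_L)` (the tree's `Godement.conjAct`). For a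
subset `B ⊆ M_N(𝔸_L)` and `g ∈ GL_N(𝔸_L)` consider the set of RATIONAL HERMITIAN matrices carried into
`B` by `g`,

  `S_B(g) = {h ∈ M_N(L) : (c h)ᵀ = h, (c g)ᵀ h_𝔸 g ∈ B}`

(written inline below; `h_𝔸 = h.map (algebraMap L 𝔸_L)`). Its cardinality `Θ_B(g) = #S_B(g)` is the
"hermitian orbit count" through which the covolume of the unitary group `U(H)(L⁺) ≤ U(H)(𝔸_{L⁺})` is
bounded against the reduction theory of `GL_N` over `L` (Borel (1963), §5, proof of Thm. 5.8 for the
stabiliser of a vector with closed orbit; Godement, Sém. Bourbaki 257, §8): unfolding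
`∫_{GL_N(𝔸_L)} #{u ∈ F_U : u⁻¹ g ∈ Q} dg` over `GL_N(L)` regroups the rational translates by the
hermitian matrices `(c γ)ᵀ H γ`. This file proves the three formal properties of `S_B` that the
count estimate uses:

* `encard_hermitianOrbitSet_toAdeleGL_mul` — **invariance under `GL_N(L)` on the left**:
  `#S_B(γ₀ g) = #S_B(g)` (the bijection `h ↦ (c γ₀)ᵀ h γ₀` of rational hermitian matrices);
* `finite_hermitianOrbitSet` — **finiteness for compact `B`** (`h ↦ h_𝔸` is injective into the compact
  set `B · g⁻¹`, which meets `M_N(L)` in a finite set, `Godement.finite_inter_principalMatrices`);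
* `exists_isCompact_hermitianOrbitSet_posRealDiagonal_mul_subset` — **box form on a Siegel slice**: for a compact
  `C₀ ⊆ GL_N(𝔸_L)` there is a compact `B₂` with `S_B(diag(z(a)) · c) ⊆ {h hermitian : diag(z(a)) h_𝔸 diag(z(a)) ∈ B₂}`
  for every positive real diagonal `diag(z(a))` (`posRealDiagonal`, fixed by `c` and symmetric) and every
  `c ∈ C₀` — the right-hand set is the one counted by the geometry-of-numbers estimate
  (`HermitianRationalPointCount`).

Written for the S3 pool of the cell `pub/hodgecm-mathlib` (ENGINE T1 line `F0_T1InnerFormTraceIdentity`,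
brick T5c-α). HC_CM is proved only modulo the printed citations until rung 0 closes; this file is
unconditional.

## References

* A. Borel, *Some finiteness properties of adele groups over number fields*, Publ. Math. IHÉS 16 (1963),
  §5, Thm. 5.8 [Borel1963].
* R. Godement, *Domaines fondamentaux des groupes arithmétiques*, Sém. Bourbaki 257 (1962/63), §8
  [Godement1964].
-/

noncomputable section

open NumberField IsDedekindDomain Matrix Set
open scoped MatrixGroups NNReal Pointwise

namespace Literature.NumberTheory.Automorphic

open Literature.NumberTheory.Automorphic.Godement
open Literature.NumberTheory.QuadraticForms (Landherr.conjTranspose Landherr.conjTranspose_mul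
  Landherr.conjTranspose_one Landherr.conjTranspose_congr)

variable (L : Type) [Field L] [NumberField L] [IsCMField L] {N : ℕ}

/-! ### The rational congruence `h ↦ (c γ₀)ᵀ h γ₀` -/

/-- **The action of a rational matrix on the base change of a rational matrix**:
`(h_𝔸) · γ₀ = ((c γ₀)ᵀ h γ₀)_𝔸` (the rational translates of `H` regrouped by the hermitian matrices
`(c γ)ᵀ H γ`, Borel's proof of Thm. 5.8). [cite: Borel1963, §5 (proof of Thm. 5.8)] -/
theorem conjAct_map_toAdeleGL (h : Matrix (Fin N) (Fin N) L) (γ₀ : GL (Fin N) L) :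
    (conjAct L).act (h.map (algebraMap L (AdeleRing (𝓞 L) L))) (toAdeleGL L γ₀) =
      (((γ₀ : Matrix (Fin N) (Fin N) L).map (cmConjRingHom L))ᵀ * h * (γ₀ : Matrix (Fin N) (Fin N) L)).map
        (algebraMap L (AdeleRing (𝓞 L) L)) := by
  rw [conjAct_act, val_toAdeleGL, map_map_adeleConj, ← Matrix.transpose_map, ← Matrix.map_mul,
    ← Matrix.map_mul]

/-- **`#S_B(γ₀ g) = #S_B(g)` for rational `γ₀`**: the set of rational hermitian `h` with
`(c(γ₀ g))ᵀ h_𝔸 (γ₀ g) ∈ B` is carried bijectively onto the set for `g` by `h ↦ (c γ₀)ᵀ h γ₀`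
(`X · (γ₀ g) = (X · γ₀) · g` and `h_𝔸 · γ₀ = ((c γ₀)ᵀ h γ₀)_𝔸`). This is the left-`GL_N(L)`-invariance
of the hermitian orbit count. [cite: Borel1963, §5 (proof of Thm. 5.8)] -/
theorem encard_hermitianOrbitSet_toAdeleGL_mul (B : Set (Matrix (Fin N) (Fin N) (AdeleRing (𝓞 L) L)))
    (γ₀ : GL (Fin N) L) (g : GL (Fin N) (AdeleRing (𝓞 L) L)) :
    {h : Matrix (Fin N) (Fin N) L | (h.map (cmConjRingHom L))ᵀ = h ∧
        (conjAct L).act (h.map (algebraMap L (AdeleRing (𝓞 L) L))) (toAdeleGL L γ₀ * g) ∈ B}.encard =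
      {h : Matrix (Fin N) (Fin N) L | (h.map (cmConjRingHom L))ᵀ = h ∧
        (conjAct L).act (h.map (algebraMap L (AdeleRing (𝓞 L) L))) g ∈ B}.encard := by
  classical
  have hγγ : ((γ₀⁻¹ : GL (Fin N) L) : Matrix (Fin N) (Fin N) L) * (γ₀ : Matrix (Fin N) (Fin N) L) = 1 := by
    rw [← Units.val_mul, inv_mul_cancel, Units.val_one]
  have hγγ' : (γ₀ : Matrix (Fin N) (Fin N) L) * ((γ₀⁻¹ : GL (Fin N) L) : Matrix (Fin N) (Fin N) L) = 1 := by
    rw [← Units.val_mul, mul_inv_cancel, Units.val_one]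
  -- the congruence by `γ₀` as an equivalence of `M_N(L)`, with inverse the congruence by `γ₀⁻¹`
  let e : Matrix (Fin N) (Fin N) L ≃ Matrix (Fin N) (Fin N) L :=
    { toFun := fun h => Landherr.conjTranspose L (γ₀ : Matrix (Fin N) (Fin N) L) * h *
        (γ₀ : Matrix (Fin N) (Fin N) L)
      invFun := fun h => Landherr.conjTranspose L ((γ₀⁻¹ : GL (Fin N) L) : Matrix (Fin N) (Fin N) L) * h *
        ((γ₀⁻¹ : GL (Fin N) L) : Matrix (Fin N) (Fin N) L)
      left_inv := fun h => by
        change Landherr.conjTranspose L ((γ₀⁻¹ : GL (Fin N) L) : Matrix (Fin N) (Fin N) L) *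
          (Landherr.conjTranspose L (γ₀ : Matrix (Fin N) (Fin N) L) * h * (γ₀ : Matrix (Fin N) (Fin N) L)) *
          ((γ₀⁻¹ : GL (Fin N) L) : Matrix (Fin N) (Fin N) L) = h
        calc _ = (Landherr.conjTranspose L ((γ₀⁻¹ : GL (Fin N) L) : Matrix (Fin N) (Fin N) L) *
              Landherr.conjTranspose L (γ₀ : Matrix (Fin N) (Fin N) L)) * h *
            ((γ₀ : Matrix (Fin N) (Fin N) L) * ((γ₀⁻¹ : GL (Fin N) L) : Matrix (Fin N) (Fin N) L)) := by
              simp only [Matrix.mul_assoc]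
          _ = h := by
              rw [← Landherr.conjTranspose_mul, hγγ', Landherr.conjTranspose_one, Matrix.one_mul,
                Matrix.mul_one]
      right_inv := fun h => by
        change Landherr.conjTranspose L (γ₀ : Matrix (Fin N) (Fin N) L) *
          (Landherr.conjTranspose L ((γ₀⁻¹ : GL (Fin N) L) : Matrix (Fin N) (Fin N) L) * h *
            ((γ₀⁻¹ : GL (Fin N) L) : Matrix (Fin N) (Fin N) L)) * (γ₀ : Matrix (Fin N) (Fin N) L) = h
        calc _ = (Landherr.conjTranspose L (γ₀ : Matrix (Fin N) (Fin N) L) *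
              Landherr.conjTranspose L ((γ₀⁻¹ : GL (Fin N) L) : Matrix (Fin N) (Fin N) L)) * h *
            (((γ₀⁻¹ : GL (Fin N) L) : Matrix (Fin N) (Fin N) L) * (γ₀ : Matrix (Fin N) (Fin N) L)) := by
              simp only [Matrix.mul_assoc]
          _ = h := by
              rw [← Landherr.conjTranspose_mul, hγγ, Landherr.conjTranspose_one, Matrix.one_mul,
                Matrix.mul_one] }
  have he : ∀ h, e h = Landherr.conjTranspose L (γ₀ : Matrix (Fin N) (Fin N) L) * h *
      (γ₀ : Matrix (Fin N) (Fin N) L) := fun h => rfl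
  -- `S_B(γ₀ g) = e ⁻¹' S_B(g)`
  have hset : {h : Matrix (Fin N) (Fin N) L | (h.map (cmConjRingHom L))ᵀ = h ∧
        (conjAct L).act (h.map (algebraMap L (AdeleRing (𝓞 L) L))) (toAdeleGL L γ₀ * g) ∈ B} =
      e ⁻¹' {h : Matrix (Fin N) (Fin N) L | (h.map (cmConjRingHom L))ᵀ = h ∧
        (conjAct L).act (h.map (algebraMap L (AdeleRing (𝓞 L) L))) g ∈ B} := by
    ext h
    simp only [Set.mem_setOf_eq, Set.mem_preimage, he]
    have hact : (conjAct L).act (h.map (algebraMap L (AdeleRing (𝓞 L) L))) (toAdeleGL L γ₀ * g) =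
        (conjAct L).act ((Landherr.conjTranspose L (γ₀ : Matrix (Fin N) (Fin N) L) * h *
          (γ₀ : Matrix (Fin N) (Fin N) L)).map (algebraMap L (AdeleRing (𝓞 L) L))) g := by
      rw [(conjAct L).act_mul, conjAct_map_toAdeleGL]
      rfl
    rw [hact]
    refine and_congr_left fun _ => ⟨fun hh => ?_, fun hh => ?_⟩
    · exact Landherr.conjTranspose_congr L (G := (γ₀ : Matrix (Fin N) (Fin N) L)) hh
    · have hh' : Landherr.conjTranspose L (Landherr.conjTranspose L (γ₀ : Matrix (Fin N) (Fin N) L) * h *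
          (γ₀ : Matrix (Fin N) (Fin N) L)) =
          Landherr.conjTranspose L (γ₀ : Matrix (Fin N) (Fin N) L) * h * (γ₀ : Matrix (Fin N) (Fin N) L) := hh
      have h2 := Landherr.conjTranspose_congr L (G := ((γ₀⁻¹ : GL (Fin N) L) : Matrix (Fin N) (Fin N) L)) hh'
      have h3 : Landherr.conjTranspose L ((γ₀⁻¹ : GL (Fin N) L) : Matrix (Fin N) (Fin N) L) *
          (Landherr.conjTranspose L (γ₀ : Matrix (Fin N) (Fin N) L) * h * (γ₀ : Matrix (Fin N) (Fin N) L)) *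
          ((γ₀⁻¹ : GL (Fin N) L) : Matrix (Fin N) (Fin N) L) = h := e.left_inv h
      rw [h3] at h2
      exact h2
  rw [hset, ← Equiv.image_symm_eq_preimage]
  exact e.symm.injective.encard_image _

/-! ### Finiteness -/

/-- **`S_B(g)` is finite for compact `B`**: `h ↦ h_𝔸` maps it injectively into the principal matrices
lying in the compact set `B · g⁻¹`, a finite set (`Godement.finite_inter_principalMatrices`).
[cite: Borel1963, §5 (proof of Thm. 5.8)] -/
theorem finite_hermitianOrbitSet {B : Set (Matrix (Fin N) (Fin N) (AdeleRing (𝓞 L) L))} (hB : IsCompact B)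
    (g : GL (Fin N) (AdeleRing (𝓞 L) L)) :
    {h : Matrix (Fin N) (Fin N) L | (h.map (cmConjRingHom L))ᵀ = h ∧
        (conjAct L).act (h.map (algebraMap L (AdeleRing (𝓞 L) L))) g ∈ B}.Finite := by
  classical
  -- the compact set `B · g⁻¹`
  have hc : Continuous fun X : Matrix (Fin N) (Fin N) (AdeleRing (𝓞 L) L) => (conjAct L).act X g⁻¹ := by
    simp only [conjAct_act]
    exact (continuous_const.matrix_mul continuous_id).matrix_mul continuous_const
  have hfin := finite_inter_principalMatrices L (n := Fin N) (hB.image hc)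
  -- `h ↦ h_𝔸` is injective and lands in it
  haveI : Nontrivial (AdeleRing (𝓞 L) L) :=
    inferInstanceAs (Nontrivial (InfiniteAdeleRing L × FiniteAdeleRing (𝓞 L) L))
  have hinj : Function.Injective fun h : Matrix (Fin N) (Fin N) L => h.map (algebraMap L (AdeleRing (𝓞 L) L)) :=
    fun _ _ hxy => Matrix.map_injective (algebraMap L (AdeleRing (𝓞 L) L)).injective hxy
  refine (hfin.preimage hinj.injOn).subset fun h hh => ?_
  refine ⟨⟨_, hh.2, ?_⟩, fun i j => ⟨_, rfl⟩⟩
  change (conjAct L).act ((conjAct L).act _ g) g⁻¹ = _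
  rw [← (conjAct L).act_mul, mul_inv_cancel, (conjAct L).act_one]

/-- **The hermitian orbit count is a natural number**: `#S_B(g) < ∞` as an `ℕ∞`. [cite: Borel1963, §5 (proof of Thm. 5.8)] -/
theorem encard_hermitianOrbitSet_lt_top {B : Set (Matrix (Fin N) (Fin N) (AdeleRing (𝓞 L) L))}
    (hB : IsCompact B) (g : GL (Fin N) (AdeleRing (𝓞 L) L)) :
    {h : Matrix (Fin N) (Fin N) L | (h.map (cmConjRingHom L))ᵀ = h ∧
        (conjAct L).act (h.map (algebraMap L (AdeleRing (𝓞 L) L))) g ∈ B}.encard < ⊤ :=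
  (finite_hermitianOrbitSet L hB g).encard_lt_top

/-! ### Box form on a Siegel slice -/

/-- `c` fixes the positive real ideles: `c(z(r)) = z(r)` (the archimedean part of `z(r)` is a real scalar,
its finite part is `1`). [folklore] -/
private theorem adeleConj_posRealIdele (r : ℝ≥0ˣ) :
    adeleConj L ((posRealIdele L r : (AdeleRing (𝓞 L) L)ˣ) : AdeleRing (𝓞 L) L) =
      ((posRealIdele L r : (AdeleRing (𝓞 L) L)ˣ) : AdeleRing (𝓞 L) L) := by
  rw [adeleConj_apply]
  refine Prod.ext ?_ ?_
  · rw [AdeleRing.smul_fst, posRealIdele_fst,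
      InfiniteAdeleRing.smul_realToInfiniteAdele (↥(maximalRealSubfield L)) (IsCMField.complexConj L)]
  · rw [AdeleRing.smul_snd, posRealIdele_snd, smul_one]

/-- `c` fixes positive real diagonal matrices: `c(diag(z(a))) = diag(z(a))`. [folklore] -/
private theorem map_adeleConj_posRealDiagonal (a : Fin N → ℝ≥0ˣ) :
    (posRealDiagonal N L a : Matrix (Fin N) (Fin N) (AdeleRing (𝓞 L) L)).map (adeleConj L) =
      (posRealDiagonal N L a : Matrix (Fin N) (Fin N) (AdeleRing (𝓞 L) L)) := by
  rw [coe_posRealDiagonal, Matrix.diagonal_map (map_zero _)]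
  congr 1
  funext i
  exact adeleConj_posRealIdele L (a i)

omit [IsCMField L] in
/-- Positive real diagonal matrices are symmetric. [folklore] -/
private theorem transpose_posRealDiagonal (a : Fin N → ℝ≥0ˣ) :
    (posRealDiagonal N L a : Matrix (Fin N) (Fin N) (AdeleRing (𝓞 L) L))ᵀ =
      (posRealDiagonal N L a : Matrix (Fin N) (Fin N) (AdeleRing (𝓞 L) L)) := by
  rw [coe_posRealDiagonal, Matrix.diagonal_transpose]

/-- **The action of a positive real diagonal matrix** `d = diag(z(a))`: `X · d = d X d` (as `c d = d = dᵀ`;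
the Siegel-slice form of the hermitian box, Borel's proof of Thm. 5.8). [cite: Borel1963, §5 (proof of Thm. 5.8)] -/
theorem conjAct_posRealDiagonal (X : Matrix (Fin N) (Fin N) (AdeleRing (𝓞 L) L)) (a : Fin N → ℝ≥0ˣ) :
    (conjAct L).act X (posRealDiagonal N L a) =
      (posRealDiagonal N L a : Matrix (Fin N) (Fin N) (AdeleRing (𝓞 L) L)) * X *
        (posRealDiagonal N L a : Matrix (Fin N) (Fin N) (AdeleRing (𝓞 L) L)) := by
  rw [conjAct_act, map_adeleConj_posRealDiagonal, transpose_posRealDiagonal]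

/-- **Box form of `S_B` on a Siegel slice.** For compact `B ⊆ M_N(𝔸_L)` and `C₀ ⊆ GL_N(𝔸_L)` there is a
compact `B₂ ⊆ M_N(𝔸_L)` (namely the image of `C₀ × B` under `(c, b) ↦ (c c⁻¹)ᵀ b c⁻¹ = b · c⁻¹`) such
that for every positive real diagonal `d = diag(z(a))` and every `c ∈ C₀`:
`S_B(d c) ⊆ {h ∈ M_N(L) : (c h)ᵀ = h, d h_𝔸 d ∈ B₂}` — since `h_𝔸 · (d c) = (d h_𝔸 d) · c` and
`(d h_𝔸 d) = (h_𝔸 · d c) · c⁻¹`. The right-hand side is the set counted by the geometry of numbers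
(`HermitianRationalPointCount`). [cite: Borel1963, §5 (proof of Thm. 5.8)] -/
theorem exists_isCompact_hermitianOrbitSet_posRealDiagonal_mul_subset (N : ℕ)
    {B : Set (Matrix (Fin N) (Fin N) (AdeleRing (𝓞 L) L))}
    (hB : IsCompact B) {C₀ : Set (GL (Fin N) (AdeleRing (𝓞 L) L))} (hC₀ : IsCompact C₀) :
    ∃ B₂ : Set (Matrix (Fin N) (Fin N) (AdeleRing (𝓞 L) L)), IsCompact B₂ ∧
      ∀ (a : Fin N → ℝ≥0ˣ) (c : GL (Fin N) (AdeleRing (𝓞 L) L)), c ∈ C₀ →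
        {h : Matrix (Fin N) (Fin N) L | (h.map (cmConjRingHom L))ᵀ = h ∧
            (conjAct L).act (h.map (algebraMap L (AdeleRing (𝓞 L) L))) (posRealDiagonal N L a * c) ∈ B} ⊆
          {h : Matrix (Fin N) (Fin N) L | (h.map (cmConjRingHom L))ᵀ = h ∧
            (posRealDiagonal N L a : Matrix (Fin N) (Fin N) (AdeleRing (𝓞 L) L)) *
                h.map (algebraMap L (AdeleRing (𝓞 L) L)) *
              (posRealDiagonal N L a : Matrix (Fin N) (Fin N) (AdeleRing (𝓞 L) L)) ∈ B₂} := by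
  -- `B₂ = {b · c⁻¹ : c ∈ C₀, b ∈ B}`
  set F : GL (Fin N) (AdeleRing (𝓞 L) L) × Matrix (Fin N) (Fin N) (AdeleRing (𝓞 L) L) →
      Matrix (Fin N) (Fin N) (AdeleRing (𝓞 L) L) := fun p => (conjAct L).act p.2 p.1⁻¹ with hF
  have hFc : Continuous F := by
    simp only [hF, conjAct_act]
    have h1 : Continuous fun p : GL (Fin N) (AdeleRing (𝓞 L) L) × Matrix (Fin N) (Fin N) (AdeleRing (𝓞 L) L) =>
        ((p.1⁻¹ : GL (Fin N) (AdeleRing (𝓞 L) L)) : Matrix (Fin N) (Fin N) (AdeleRing (𝓞 L) L)) :=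
      Units.continuous_val.comp (continuous_inv.comp continuous_fst)
    exact ((h1.matrix_map (continuous_adeleConj L)).matrix_transpose.matrix_mul continuous_snd).matrix_mul h1
  refine ⟨F '' (C₀ ×ˢ B), (hC₀.prod hB).image hFc, fun a c hc h hh => ⟨hh.1, ?_⟩⟩
  -- `d h_𝔸 d = (h_𝔸 · (d c)) · c⁻¹`
  refine ⟨(c, (conjAct L).act (h.map (algebraMap L (AdeleRing (𝓞 L) L))) (posRealDiagonal N L a * c)),
    ⟨hc, hh.2⟩, ?_⟩
  change (conjAct L).act ((conjAct L).act _ (posRealDiagonal N L a * c)) c⁻¹ = _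
  rw [← (conjAct L).act_mul, mul_assoc, mul_inv_cancel, mul_one, conjAct_posRealDiagonal]

end Literature.NumberTheory.Automorphic

end
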